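import Summits.CriticalPhenomena.Ising3DConformalLimit.Theorems.EnergyNotSigmaSquaredMoebiusLimitExistsClusterMoveIneqAux
import Summits.CriticalPhenomena.Ising3DConformalLimit.Theorems.EnergyNotSigmaSquaredMoebiusLimitExistsPedigreeDefs
import Summits.CriticalPhenomena.Ising3DConformalLimit.Theorems.MoebiusLimitExists.Negative.FreePermutations
import HarnessLib

/-!
# The cluster move inequality in the nine cubic site-mirror families of `ℤ³`
(stub `clusterMoveIneq_cubic` of line `only-interaction-breaks-moebius`, crux `MoebiusLimitExists`,
item stmt-CriticalPhenomena-1344, route `EnergyNotSigmaSquared`)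

Contents.
* Uniform algebra of the integer dot product `zdot g` and of the lattice mirrors
  `latticeMirror g c : v ↦ v − (2 (g·v − c)/‖g‖²) g` for a cubic direction `g`
  (`IsCubicDir g`: entries in `{−1, 0, 1}`, `‖g‖² ∈ {1, 2}`): the height `g·v − c` flips sign,
  the mirror is involutive and fixes its plane, and the mirror at height `c` is the conjugate of the
  mirror through the origin by a lattice translation `w` with `g·w = c` (`exists_zdot_eq_cm`,
  `latticeMirror_eq_conj_cm`).
* `exists_signedPerm_eq_latticeMirror_cm`: the mirror through the origin is a signed coordinate
  permutation of `ℤ³` (the only case analysis of the file: coordinate mirrors `v_τ ↦ −v_τ`,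
  diagonal mirrors `(v_τ, v_τ') ↦ (v_τ', v_τ)` and anti-diagonal mirrors
  `(v_τ, v_τ') ↦ (−v_τ', −v_τ)`); hence it maps neighbours to neighbours, preserves the boxes and
  leaves the critical correlators invariant (`criticalCorr_signedPerm`), and the general site-mirror
  reflection positivity `rp_criticalCorr` applies with the height `zdot g`, which is `1`-Lipschitz
  along edges (`zdot_adj_cm`).
* `clusterMoveIneq_cubic` (registered): for every cubic direction `g` and every integer height `c`,
  the critical correlators are invariant under `latticeMirror g c`, and the CLUSTER MOVE INEQUALITY
  `(⟨Πσ_{y_A}Πσ_{y_B}⟩ − ⟨Πσ_{y'_A}Πσ_{y_B}⟩)² ≤ [⟨S_AΘS_A⟩ − 2⟨S_AΘS'_A⟩ + ⟨S'_AΘS'_A⟩]·⟨ΘS_B S_B⟩`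
  holds for a cluster `y_A ⊆ {g· ≤ c}`, a block `y_B ⊆ {g· ≥ c}` and `y'_A` differing from `y_A`
  at one index (`clusterMoveIneq_of_rp` of the companion file `…ClusterMoveIneqAux.lean`, fed with
  the invariance and the positivity transported to height `c` by `criticalCorr_conj_translate`,
  `rp_conj_translate`).

References: J. Fröhlich, R. Israel, E. H. Lieb, B. Simon, Comm. Math. Phys. 62 (1978) 1–34, §2
[FILS1978] (site-mirror reflection positivity in the coordinate and diagonal planes of `ℤ^d`);
S. Friedli, Y. Velenik, *Statistical Mechanics of Lattice Systems* (CUP 2017), Lemma 10.8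
[FriedliVelenik2017]. No new definitions.
-- the three mirror families are ported from Cruxes/MoebiusLimitExists/Disproof.lean §G.1″
-/

noncomputable section

open Filter Topology Set Function
open Literature.Probability.LatticeModels

namespace Summit.CriticalPhenomena.Ising3DConformalLimit.MoebiusLimitExistsOnlyInteraction

open Literature.Probability.Percolation (zdGraph_adj_signedPerm signedPerm_mem_box_iff)
open Summit.CriticalPhenomena.Ising3DConformalLimit.MoebiusLimitExistsNegative (criticalCorr_signedPerm)

/-! ### Uniform algebra of `zdot` and of the lattice mirrors -/

/-- `zdot g` is additive. [folklore] -/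
theorem zdot_add_cm (g v w : Site 3) : zdot g (v + w) = zdot g v + zdot g w := by
  simp only [zdot, Pi.add_apply]
  ring

/-- `zdot g` commutes with subtraction. [folklore] -/
theorem zdot_sub_cm (g v w : Site 3) : zdot g (v - w) = zdot g v - zdot g w := by
  simp only [zdot, Pi.sub_apply]
  ring

/-- `zdot g` is homogeneous. [folklore] -/
theorem zdot_smul_cm (g v : Site 3) (k : ℤ) : zdot g (k • v) = k * zdot g v := by
  simp only [zdot, Pi.smul_apply, smul_eq_mul]
  ring

/-- `zdot g eτ = g τ`. [folklore] -/
theorem zdot_single_cm (g : Site 3) (τ : Fin 3) : zdot g (Pi.single τ 1) = g τ := by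
  fin_cases τ <;> simp [zdot]

/-- For a cubic direction, `(2 / ‖g‖²) · ‖g‖² = 2` in `ℤ` (`‖g‖² ∈ {1, 2}`). [folklore] -/
theorem two_div_mul_zdot_cm {g : Site 3} (hg : IsCubicDir g) : 2 / zdot g g * zdot g g = 2 := by
  rcases hg.2 with h | h <;> rw [h] <;> decide

/-- The height `g·v − c` flips sign under the mirror `latticeMirror g c`. [folklore] -/
theorem zdot_latticeMirror_cm {g : Site 3} (hg : IsCubicDir g) (c : ℤ) (v : Site 3) :
    zdot g (latticeMirror g c v) - c = -(zdot g v - c) := by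
  unfold latticeMirror
  rw [zdot_sub_cm, zdot_smul_cm, mul_right_comm, two_div_mul_zdot_cm hg]
  ring

/-- The mirror `latticeMirror g c` fixes its plane `{g· = c}` pointwise. [folklore] -/
theorem latticeMirror_of_zdot_eq_cm (g : Site 3) {c : ℤ} {v : Site 3} (hv : zdot g v = c) :
    latticeMirror g c v = v := by
  unfold latticeMirror
  rw [hv, sub_self, mul_zero, zero_smul, sub_zero]

/-- The mirror `latticeMirror g c` of a cubic direction is involutive. [folklore] -/
theorem latticeMirror_latticeMirror_cm {g : Site 3} (hg : IsCubicDir g) (c : ℤ) (v : Site 3) :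
    latticeMirror g c (latticeMirror g c v) = v := by
  show latticeMirror g c v - (2 / zdot g g * (zdot g (latticeMirror g c v) - c)) • g = v
  rw [zdot_latticeMirror_cm hg c v, mul_neg, neg_smul, sub_neg_eq_add]
  unfold latticeMirror
  rw [sub_add_cancel]

/-- Every mirror plane `{g· = c}` of a cubic direction contains a lattice point. [folklore] -/
theorem exists_zdot_eq_cm {g : Site 3} (hg : IsCubicDir g) (c : ℤ) : ∃ w : Site 3, zdot g w = c := by
  obtain ⟨hg1, hn⟩ := hg
  rcases hg1 0 with h0 | h0 | h0
  · exact ⟨![-c, 0, 0], by simp [zdot, h0]⟩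
  swap
  · exact ⟨![c, 0, 0], by simp [zdot, h0]⟩
  rcases hg1 1 with h1 | h1 | h1
  · exact ⟨![0, -c, 0], by simp [zdot, h1]⟩
  swap
  · exact ⟨![0, c, 0], by simp [zdot, h1]⟩
  rcases hg1 2 with h2 | h2 | h2
  · exact ⟨![0, 0, -c], by simp [zdot, h2]⟩
  swap
  · exact ⟨![0, 0, c], by simp [zdot, h2]⟩
  exfalso
  simp [zdot, h0, h1, h2] at hn

/-- The mirror at height `c = g·w` is the conjugate of the mirror through the origin by the lattice
translation `w`. [folklore] -/
theorem latticeMirror_eq_conj_cm (g : Site 3) {c : ℤ} {w : Site 3} (hw : zdot g w = c) :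
    latticeMirror g c = fun v => latticeMirror g 0 (v - w) + w := by
  funext v
  simp only [latticeMirror, zdot_sub_cm, hw, sub_zero]
  rw [sub_right_comm, sub_add_cancel]

/-- The height `zdot g` of a cubic direction is `1`-Lipschitz along the edges of `ℤ³`. [folklore] -/
theorem zdot_adj_cm {g : Site 3} (hg : IsCubicDir g) (x y : Site 3) (h : (zdGraph 3).Adj x y) :
    zdot g x ≤ zdot g y + 1 ∧ zdot g y ≤ zdot g x + 1 := by
  rw [zdGraph_adj_iff] at h
  obtain ⟨i, hi⟩ := h
  have hgi : -1 ≤ g i ∧ g i ≤ 1 := by rcases hg.1 i with h | h | h <;> omega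
  rcases hi with rfl | rfl <;> rw [zdot_add_cm, zdot_single_cm] <;> omega

/-! ### The mirrors through the origin are signed coordinate permutations -/

/-- **The cubic mirrors through the origin are hyperoctahedral.** For a cubic direction `g`, the
mirror `latticeMirror g 0` is a signed coordinate permutation of `ℤ³`: `v_τ ↦ −v_τ` for
`g = ±e_τ`, `(v_τ, v_τ') ↦ (−v_τ', −v_τ)` for `g = ±(e_τ + e_τ')`, `(v_τ, v_τ') ↦ (v_τ', v_τ)` for
`g = ±(e_τ − e_τ')`. [folklore] -/
theorem exists_signedPerm_eq_latticeMirror_cm {g : Site 3} (hg : IsCubicDir g) :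
    ∃ (π : Equiv.Perm (Fin 3)) (ε : Fin 3 → ℤˣ), ∀ v, latticeMirror g 0 v = Site.signedPerm π ε v := by
  -- ported from Cruxes/MoebiusLimitExists/Disproof.lean §G.1″ (the three families `isRPMirror_coord`,
  -- `isRPMirror_swap`, `isRPMirror_antiswap`), here read off the closed formula `latticeMirror_apply`
  obtain ⟨hg1, hn⟩ := hg
  rcases hg1 0 with h0 | h0 | h0 <;> rcases hg1 1 with h1 | h1 | h1 <;> rcases hg1 2 with h2 | h2 | h2
  all_goals first
    | (simp [zdot, h0, h1, h2] at hn; done)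
    | (refine ⟨Equiv.refl _, ![-1, 1, 1], fun v => funext fun j => ?_⟩
       fin_cases j <;> simp [latticeMirror_apply, zdot, h0, h1, h2] <;> omega)
    | (refine ⟨Equiv.refl _, ![1, -1, 1], fun v => funext fun j => ?_⟩
       fin_cases j <;> simp [latticeMirror_apply, zdot, h0, h1, h2] <;> omega)
    | (refine ⟨Equiv.refl _, ![1, 1, -1], fun v => funext fun j => ?_⟩
       fin_cases j <;> simp [latticeMirror_apply, zdot, h0, h1, h2] <;> omega)
    | (refine ⟨Equiv.swap 0 1, ![-1, -1, 1], fun v => funext fun j => ?_⟩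
       fin_cases j <;>
         simp [latticeMirror_apply, zdot, h0, h1, h2, Equiv.swap_apply_of_ne_of_ne] <;> omega)
    | (refine ⟨Equiv.swap 0 1, 1, fun v => funext fun j => ?_⟩
       fin_cases j <;>
         simp [latticeMirror_apply, zdot, h0, h1, h2, Equiv.swap_apply_of_ne_of_ne] <;> omega)
    | (refine ⟨Equiv.swap 0 2, ![-1, 1, -1], fun v => funext fun j => ?_⟩
       fin_cases j <;>
         simp [latticeMirror_apply, zdot, h0, h1, h2, Equiv.swap_apply_of_ne_of_ne] <;> omega)
    | (refine ⟨Equiv.swap 0 2, 1, fun v => funext fun j => ?_⟩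
       fin_cases j <;>
         simp [latticeMirror_apply, zdot, h0, h1, h2, Equiv.swap_apply_of_ne_of_ne] <;> omega)
    | (refine ⟨Equiv.swap 1 2, ![1, -1, -1], fun v => funext fun j => ?_⟩
       fin_cases j <;>
         simp [latticeMirror_apply, zdot, h0, h1, h2, Equiv.swap_apply_of_ne_of_ne] <;> omega)
    | (refine ⟨Equiv.swap 1 2, 1, fun v => funext fun j => ?_⟩
       fin_cases j <;> simp [latticeMirror_apply, zdot, h0, h1, h2, Equiv.swap_apply_of_ne_of_ne])

/-- Invariance of the critical correlators under the cubic mirrors through the origin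
(`criticalCorr_signedPerm`). [cite: FriedliVelenik2017, Exercise 3.14, p. 115] -/
theorem criticalCorr_latticeMirror_zero_cm {g : Site 3} (hg : IsCubicDir g) (n : ℕ)
    (y : Fin n → Site 3) : criticalCorr 3 n (latticeMirror g 0 ∘ y) = criticalCorr 3 n y := by
  obtain ⟨π, ε, hπε⟩ := exists_signedPerm_eq_latticeMirror_cm hg
  rw [show latticeMirror g 0 = ⇑(Site.signedPerm π ε) from funext hπε]
  exact criticalCorr_signedPerm π ε y

/-- **Site-mirror reflection positivity of the critical `ℤ³` correlators in the cubic mirrors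
through the origin**: the Gram form `(z, z') ↦ ⟨∏σ_{θz} ∏σ_{z'}⟩_{β_c}`, `θ = latticeMirror g 0`, is
positive semidefinite on spin monomials supported in `{g· ≥ 0}` (`rp_criticalCorr` for the signed
permutation `θ` with the height `zdot g`). [cite: FILS1978, §2] -/
theorem rp_latticeMirror_zero_cm {g : Site 3} (hg : IsCubicDir g) (m : ℕ) (k : Fin m → ℕ)
    (z : (a : Fin m) → Fin (k a) → Site 3) (c : Fin m → ℝ) (hz : ∀ a j, 0 ≤ zdot g (z a j)) :
    0 ≤ ∑ a, ∑ b, c a * c b *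
      criticalCorr 3 (k a + k b) (Fin.append (latticeMirror g 0 ∘ z a) (z b)) := by
  obtain ⟨π, ε, hπε⟩ := exists_signedPerm_eq_latticeMirror_cm hg
  have hfun : latticeMirror g 0 = ⇑(Site.signedPerm π ε) := funext hπε
  rw [hfun]
  refine rp_criticalCorr (Site.signedPerm π ε) ?_ (fun x y h => zdGraph_adj_signedPerm π ε h)
    (fun L x => (signedPerm_mem_box_iff π ε).symm) (zdot g) ?_ ?_ (zdot_adj_cm hg) m k z c hz
  · intro v
    rw [← hfun]
    exact latticeMirror_latticeMirror_cm hg 0 v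
  · intro x
    rw [← hfun]
    simpa using zdot_latticeMirror_cm hg 0 x
  · intro x hx
    rw [← hfun]
    exact latticeMirror_of_zdot_eq_cm g hx

/-! ### The registered statement -/

/-- **CLUSTER MOVE INEQUALITY in the nine cubic site-mirror families of `ℤ³`.** For every cubic
direction `g` (`g ∈ {±e_τ, ±e_τ ± e_τ'}`) and every integer height `c`, with
`Θ = latticeMirror g c` the site mirror in the plane `{g· = c}`:
(1) the critical correlators are `Θ`-invariant;
(2) for a cluster `y_A ⊆ {g· ≤ c}`, a block `y_B ⊆ {g· ≥ c}` and `y'_A` differing from `y_A` only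
at the index `i` (still below the mirror),
`(⟨Πσ_{y_A}Πσ_{y_B}⟩ − ⟨Πσ_{y'_A}Πσ_{y_B}⟩)² ≤ [⟨S_AΘS_A⟩ − 2⟨S_AΘS'_A⟩ + ⟨S'_AΘS'_A⟩]·⟨ΘS_B S_B⟩`
— reflection positivity of the critical state in the mirror (FILS) and Cauchy–Schwarz for the
Gram form (`clusterMoveIneq_of_rp`), the mirror at height `c` being conjugate to the hyperoctahedral
mirror through the origin by a lattice translation. [cite: FILS1978, §2] -/
theorem clusterMoveIneq_cubic :
    ∀ (g : Site 3), IsCubicDir g → ∀ (c : ℤ),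
      (∀ (n : ℕ) (y : Fin n → Site 3), criticalCorr 3 n (latticeMirror g c ∘ y) = criticalCorr 3 n y) ∧
      ∀ (a b : ℕ) (i : Fin a) (yA yA' : Fin a → Site 3) (yB : Fin b → Site 3),
        (∀ j, j ≠ i → yA' j = yA j) → (∀ j, zdot g (yA j) ≤ c) → zdot g (yA' i) ≤ c →
        (∀ j, c ≤ zdot g (yB j)) →
        (criticalCorr 3 (a + b) (Fin.append yA yB) - criticalCorr 3 (a + b) (Fin.append yA' yB)) ^ 2 ≤
          (criticalCorr 3 (a + a) (Fin.append yA (latticeMirror g c ∘ yA))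
            - 2 * criticalCorr 3 (a + a) (Fin.append yA (latticeMirror g c ∘ yA'))
            + criticalCorr 3 (a + a) (Fin.append yA' (latticeMirror g c ∘ yA'))) *
          criticalCorr 3 (b + b) (Fin.append (latticeMirror g c ∘ yB) yB) := by
  intro g hg c
  obtain ⟨w, hw⟩ := exists_zdot_eq_cm hg c
  have hconj : latticeMirror g c = fun v => latticeMirror g 0 (v - w) + w :=
    latticeMirror_eq_conj_cm g hw
  have hsym : ∀ (n : ℕ) (y : Fin n → Site 3),
      criticalCorr 3 n (latticeMirror g c ∘ y) = criticalCorr 3 n y := by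
    intro n y
    rw [hconj]
    exact criticalCorr_conj_translate (criticalCorr_latticeMirror_zero_cm hg) w n y
  refine ⟨hsym, ?_⟩
  intro a b i yA yA' yB hdiff hA hAi hB
  have hRP : ∀ (m : ℕ) (k : Fin m → ℕ) (z : (a : Fin m) → Fin (k a) → Site 3) (cf : Fin m → ℝ),
      (∀ a j, 0 ≤ zdot g (z a j) - c) →
      0 ≤ ∑ a, ∑ b, cf a * cf b *
        criticalCorr 3 (k a + k b) (Fin.append (latticeMirror g c ∘ z a) (z b)) := by
    intro m k z cf hz
    rw [hconj]
    exact rp_conj_translate (φ := zdot g) (rp_latticeMirror_zero_cm hg) w k z cf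
      (fun a j => by rw [zdot_sub_cm, hw]; exact hz a j)
  exact clusterMoveIneq_of_rp (Θ := latticeMirror g c) (φ := fun v => zdot g v - c)
    (latticeMirror_latticeMirror_cm hg c) (zdot_latticeMirror_cm hg c) hsym hRP hdiff
    (fun j => sub_nonpos.2 (hA j)) (sub_nonpos.2 hAi) (fun j => sub_nonneg.2 (hB j))

end Summit.CriticalPhenomena.Ising3DConformalLimit.MoebiusLimitExistsOnlyInteraction

end
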